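import Mathlib
import Summits.CriticalPhenomena.CardyFormulaZ2.Theorems.CardyWhiteToColouredDriftBoundPlackettDefs
import Summits.CriticalPhenomena.CardyFormulaZ2.Theorems.CardyWhiteToColouredDriftBoundPlackettStein

/-!
# Plackett/Piterbarg drift identity for the noise heat flow: the noise-regularised indicator is
# `C²_b`

Helper file for crux item `DriftBound` (stmt-CriticalPhenomena-4596) of route
`CardyWhiteToColoured` (`CardyFormulaZ2`), line `registered` (`Cruxes/DriftBound/Lines/birth.lean`,
skeleton v4, lead c3), sub-goal `pl_regIndicator_smooth` of the exact drift identity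
(`stub_driftIdentity`): for `η > 0` the noise-regularised indicator
`Φ_η = regIndicator I A η : ℝ^I → ℝ`, `Φ_η(x) = P_ζ({e ∈ I | x_e + η ζ_e > 0} ∈ A)` (`ζ_e` i.i.d.
`N(0,1)`), is `C²` with `Φ_η`, `DΦ_η`, `D²Φ_η` bounded (operator norms of `fderiv` and
`fderiv ∘ fderiv`).

Proof.
* Product formula (`ri_regIndicator_eq`): the event only depends on the sign pattern
  `b = (1[x_i + η ζ_i > 0])_i ∈ Bool^I`; the fibre of a pattern is the coordinate box
  `∏_i (b_i ? Ioi (−x_i/η) : Iic (−x_i/η))`, of `γ^⊗I`-measure `∏_i F_{b_i}(−x_i/η)` with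
  `F_false(t) = γ(Iic t)` (the normal distribution function) and
  `F_true(t) = γ(Ioi t) = 1 − F_false(t)` (`Measure.pi_pi`); summing over the finitely many good
  patterns
  (`sum_measureReal_preimage_singleton`) gives `Φ_η(x) = ∑_{b good} ∏_i F_{b_i}(−x_i/η)`.
* One-dimensional calculus (`ri_cdf_hasDerivAt`, `ri_cdf_contDiff`, `ri_side_bound`): by the
  fundamental theorem of calculus `F_false' = φ` (the Gaussian density), so `F_c` is `C^∞` with
  `|F_c|, |F_c'|, |F_c''| ≤ 1` (`φ ≤ 1`, `|t| φ(t) ≤ 1`).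
* Assembly (`ri_sumprod_smooth`): a finite sum of finite products of `F_c ∘ (x ↦ −x_i/η)` is
  `C^∞` (`ContDiff.sum`, `contDiff_prod`), and its iterated derivatives of order `≤ 2` are bounded
  by Mathlib's Leibniz bound `norm_iteratedFDeriv_prod_le` and the chain rule with a linear map
  (`ContinuousLinearMap.iteratedFDeriv_comp_right`); `‖fderiv‖`, `‖fderiv ∘ fderiv‖` are the
  norms of the first two iterated derivatives (`norm_iteratedFDeriv_fderiv`).

References: D. Beliaev, S. Muirhead, A. Rivera, *A covariance formula for topological events of
smooth Gaussian fields*, Ann. Probab. 48 (2020), §2.2 (regularisation of indicators in Piterbarg's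
formula). [BeliaevMuirheadRivera2020]
-/

noncomputable section

namespace Summit.CriticalPhenomena.CardyFormulaZ2.Cruxes.DriftBound.Birth

open MeasureTheory ProbabilityTheory Set
open scoped ENNReal NNReal ContDiff
open Literature.Probability.LatticeModels

/-! ### One-dimensional calculus: the standard normal distribution function -/

/-- The normal distribution function as an integral of the density:
`γ(Iic t) = ∫_{Iic t} φ`. -/
theorem ri_cdf_eq_integral (t : ℝ) :
    (gaussianReal 0 1).real (Iic t) = ∫ x in Iic t, gaussianPDFReal 0 1 x := by
  rw [measureReal_def, gaussianReal_apply_eq_integral 0 one_ne_zero,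
    ENNReal.toReal_ofReal
      (setIntegral_nonneg measurableSet_Iic fun x _ => gaussianPDFReal_nonneg _ _ _)]

/-- The Gaussian density `φ` is smooth. -/
theorem ri_pdf_contDiff {n : ℕ∞ω} : ContDiff ℝ n (gaussianPDFReal 0 1) := by
  rw [gaussianPDFReal_def]
  fun_prop

/-- **FTC for the normal distribution function**: `d/dt γ(Iic t) = φ(t)`. -/
theorem ri_cdf_hasDerivAt (t : ℝ) :
    HasDerivAt (fun s => (gaussianReal 0 1).real (Iic s)) (gaussianPDFReal 0 1 t) t := by
  have hint := integrable_gaussianPDFReal 0 1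
  have hcont : Continuous (gaussianPDFReal 0 1) := (ri_pdf_contDiff (n := 0)).continuous
  have h1 : HasDerivAt (fun u => ∫ x in (0:ℝ)..u, gaussianPDFReal 0 1 x)
      (gaussianPDFReal 0 1 t) t :=
    intervalIntegral.integral_hasDerivAt_right (hint.intervalIntegrable)
      (hcont.stronglyMeasurableAtFilter _ _) hcont.continuousAt
  have h2 : (fun s => (gaussianReal 0 1).real (Iic s)) = fun u =>
      (∫ x in Iic (0:ℝ), gaussianPDFReal 0 1 x) + ∫ x in (0:ℝ)..u, gaussianPDFReal 0 1 x := by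
    funext u
    rw [ri_cdf_eq_integral,
      ← intervalIntegral.integral_Iic_sub_Iic hint.integrableOn hint.integrableOn]
    ring
  rw [h2]
  exact h1.const_add _

/-- `(γ(Iic ·))' = φ`. -/
theorem ri_cdf_deriv :
    deriv (fun s => (gaussianReal 0 1).real (Iic s)) = gaussianPDFReal 0 1 :=
  funext fun t => (ri_cdf_hasDerivAt t).deriv

/-- `φ' (t) = -t φ(t)`. -/
theorem ri_pdf_deriv :
    deriv (gaussianPDFReal 0 1) = fun t => -t * gaussianPDFReal 0 1 t :=
  funext fun t => (pl_hasDerivAt_gaussianPDFReal t).deriv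

/-- The normal distribution function is smooth. -/
theorem ri_cdf_contDiff : ContDiff ℝ ∞ (fun s => (gaussianReal 0 1).real (Iic s)) := by
  rw [contDiff_infty_iff_deriv, ri_cdf_deriv]
  exact ⟨fun t => (ri_cdf_hasDerivAt t).differentiableAt, ri_pdf_contDiff⟩

/-- `φ ≤ 1` (indeed `φ ≤ 1/√(2π)`). -/
theorem ri_pdf_le_one (t : ℝ) : gaussianPDFReal 0 1 t ≤ 1 := by
  have hs : (1 : ℝ) ≤ √(2 * Real.pi * 1) := by
    rw [Real.one_le_sqrt]; nlinarith [Real.pi_gt_three]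
  simp only [gaussianPDFReal_def, NNReal.coe_one]
  refine mul_le_one₀ (inv_le_one_of_one_le₀ hs) (Real.exp_nonneg _) ?_
  rw [Real.exp_le_one_iff]
  have : 0 ≤ (t - 0) ^ 2 := sq_nonneg _
  apply div_nonpos_of_nonpos_of_nonneg <;> linarith

/-- `|t| φ(t) ≤ 1` (from `|t| ≤ 1 + t²/2 ≤ exp (t²/2)`), a bound for `|φ'|`. -/
theorem ri_abs_mul_pdf_le_one (t : ℝ) : |t| * gaussianPDFReal 0 1 t ≤ 1 := by
  have hs : (1 : ℝ) ≤ √(2 * Real.pi * 1) := by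
    rw [Real.one_le_sqrt]; nlinarith [Real.pi_gt_three]
  have hexp : |t| * Real.exp (-(t - 0) ^ 2 / (2 * 1)) ≤ 1 := by
    have h1 : |t| ≤ (t - 0) ^ 2 / (2 * 1) + 1 := by
      nlinarith [sq_nonneg (|t| - 1), sq_abs t]
    have h2 := Real.add_one_le_exp ((t - 0) ^ 2 / (2 * 1))
    rw [neg_div, Real.exp_neg, ← div_eq_mul_inv, div_le_one (Real.exp_pos _)]
    exact h1.trans h2
  simp only [gaussianPDFReal_def, NNReal.coe_one]
  calc |t| * ((√(2 * Real.pi * 1))⁻¹ * Real.exp (-(t - 0) ^ 2 / (2 * 1)))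
      = (√(2 * Real.pi * 1))⁻¹ * (|t| * Real.exp (-(t - 0) ^ 2 / (2 * 1))) := by ring
    _ ≤ 1 := mul_le_one₀ (inv_le_one_of_one_le₀ hs) (by positivity) hexp

/-- The normal distribution function and its first two derivatives are bounded by `1`. -/
theorem ri_cdf_iter_bound (k : ℕ) (hk : k ≤ 2) (t : ℝ) :
    ‖iteratedFDeriv ℝ k (fun s => (gaussianReal 0 1).real (Iic s)) t‖ ≤ 1 := by
  rw [norm_iteratedFDeriv_eq_norm_iteratedDeriv, Real.norm_eq_abs]
  interval_cases k
  · rw [iteratedDeriv_zero]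
    exact abs_le.2 ⟨by linarith [measureReal_nonneg (μ := gaussianReal 0 1) (s := Iic t)],
      measureReal_le_one⟩
  · rw [iteratedDeriv_one, ri_cdf_deriv, abs_of_nonneg (gaussianPDFReal_nonneg _ _ _)]
    exact ri_pdf_le_one t
  · rw [iteratedDeriv_succ, iteratedDeriv_one, ri_cdf_deriv, ri_pdf_deriv, abs_mul, abs_neg,
      abs_of_nonneg (gaussianPDFReal_nonneg _ _ _)]
    exact ri_abs_mul_pdf_le_one t

/-- `γ(Ioi s) = 1 - γ(Iic s)`. -/
theorem ri_Ioi_eq (s : ℝ) :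
    (gaussianReal 0 1).real (Ioi s) = 1 - (gaussianReal 0 1).real (Iic s) := by
  rw [← compl_Iic, probReal_compl_eq_one_sub measurableSet_Iic]

/-- The two **side functions** `F_true(s) = γ(Ioi s)`, `F_false(s) = γ(Iic s)` are smooth. -/
theorem ri_side_contDiff (b : Bool) :
    ContDiff ℝ ∞ (fun s => (gaussianReal 0 1).real (if b then Ioi s else Iic s)) := by
  cases b
  · simpa using ri_cdf_contDiff
  · simp only [if_true]
    simp_rw [ri_Ioi_eq]
    exact contDiff_const.sub ri_cdf_contDiff

/-- The side functions and their first two derivatives are bounded by `1`. -/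
theorem ri_side_bound (b : Bool) (k : ℕ) (hk : k ≤ 2) (t : ℝ) :
    ‖iteratedFDeriv ℝ k (fun s => (gaussianReal 0 1).real (if b then Ioi s else Iic s)) t‖
      ≤ 1 := by
  cases b
  · simpa using ri_cdf_iter_bound k hk t
  · have e : (fun s => (gaussianReal 0 1).real (if true then Ioi s else Iic s)) =
        fun s => 1 - (gaussianReal 0 1).real (Iic s) := by
      funext s; simp [ri_Ioi_eq]
    rw [e, norm_iteratedFDeriv_eq_norm_iteratedDeriv]
    rcases Nat.eq_zero_or_pos k with rfl | hk0
    · rw [iteratedDeriv_zero, Real.norm_eq_abs]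
      have h0 := measureReal_nonneg (μ := gaussianReal 0 1) (s := Iic t)
      have h1 := measureReal_le_one (μ := gaussianReal 0 1) (s := Iic t)
      exact abs_le.2 ⟨by linarith, by linarith⟩
    · rw [iteratedDeriv_const_sub hk0, iteratedDeriv_neg, norm_neg,
        ← norm_iteratedFDeriv_eq_norm_iteratedDeriv]
      exact ri_cdf_iter_bound k hk t

/-! ### Bounded iterated derivatives of sums of products of one-coordinate factors -/

/-- Chain rule bound: for `g : ℝ → ℝ` smooth with `|g|, |g'|, |g''| ≤ 1` and a continuous linear
functional `L`, `‖D^k (g ∘ L) x‖ ≤ ‖L‖^k` for `k ≤ 2`. -/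
theorem ri_comp_bound {E : Type*} [NormedAddCommGroup E] [NormedSpace ℝ E] {g : ℝ → ℝ}
    (hg : ContDiff ℝ ∞ g) (hb : ∀ k : ℕ, k ≤ 2 → ∀ t, ‖iteratedFDeriv ℝ k g t‖ ≤ 1)
    (L : E →L[ℝ] ℝ) {k : ℕ} (hk : k ≤ 2) (x : E) :
    ‖iteratedFDeriv ℝ k (fun y => g (L y)) x‖ ≤ ‖L‖ ^ k := by
  have h := L.iteratedFDeriv_comp_right hg x (i := k) (by exact_mod_cast le_top)
  rw [show (fun y => g (L y)) = g ∘ L from rfl, h]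
  refine (ContinuousMultilinearMap.norm_compContinuousLinearMap_le _ _).trans ?_
  rw [Finset.prod_const, Finset.card_univ, Fintype.card_fin]
  exact mul_le_of_le_one_left (pow_nonneg (norm_nonneg _) _) (hb k hk _)

/-- Coordinate version of `ri_comp_bound`: `‖D^k (y ↦ g (c y_i)) x‖ ≤ |c|^k` for `k ≤ 2`. -/
theorem ri_coord_bound {ι : Type*} [Fintype ι] {g : ℝ → ℝ} (hg : ContDiff ℝ ∞ g)
    (hb : ∀ k : ℕ, k ≤ 2 → ∀ t, ‖iteratedFDeriv ℝ k g t‖ ≤ 1) (c : ℝ) (i : ι) {k : ℕ}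
    (hk : k ≤ 2) (x : ι → ℝ) :
    ‖iteratedFDeriv ℝ k (fun y : ι → ℝ => g (c * y i)) x‖ ≤ |c| ^ k := by
  have hL : ‖c • ContinuousLinearMap.proj (R := ℝ) (φ := fun _ : ι => ℝ) i‖ ≤ |c| := by
    refine ContinuousLinearMap.opNorm_le_bound _ (abs_nonneg c) fun y => ?_
    simp only [smul_apply, ContinuousLinearMap.proj_apply, smul_eq_mul,
      norm_mul, Real.norm_eq_abs]
    exact mul_le_mul_of_nonneg_left (by simpa using norm_le_pi_norm y i) (abs_nonneg c)
  have h := ri_comp_bound hg hb (c • ContinuousLinearMap.proj (R := ℝ) (φ := fun _ : ι => ℝ) i)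
    hk x
  simp only [smul_apply, ContinuousLinearMap.proj_apply, smul_eq_mul] at h
  exact h.trans (pow_le_pow_left₀ (norm_nonneg _) hL k)

/-- Leibniz bound: if every factor `f i` is smooth with `‖D^k (f i)‖ ≤ R` for `k ≤ 2`, then for
`n ≤ 2` the `n`-th derivative of `∏_i f i` is bounded by a constant (depending on `n`, `R` and the
index type only). -/
theorem ri_prod_bound {ι E : Type*} [Fintype ι] [DecidableEq ι] [NormedAddCommGroup E]
    [NormedSpace ℝ E] {f : ι → E → ℝ} {R : ℝ} (hf : ∀ i, ContDiff ℝ ∞ (f i))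
    (hb : ∀ i (k : ℕ), k ≤ 2 → ∀ x, ‖iteratedFDeriv ℝ k (f i) x‖ ≤ R) {n : ℕ} (hn : n ≤ 2)
    (x : E) :
    ‖iteratedFDeriv ℝ n (fun y => ∏ i, f i y) x‖ ≤
      ∑ p ∈ (Finset.univ : Finset ι).sym n,
        ((p : Multiset ι).countPerms : ℝ) * R ^ Fintype.card ι := by
  refine (norm_iteratedFDeriv_prod_le (fun i _ => hf i) (by exact_mod_cast le_top)).trans ?_
  refine Finset.sum_le_sum fun p hp => ?_
  refine mul_le_mul_of_nonneg_left ?_ (Nat.cast_nonneg _)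
  rw [← Finset.card_univ, ← Finset.prod_const]
  refine Finset.prod_le_prod (fun j _ => norm_nonneg _) fun j _ => hb j _ ?_ x
  exact ((p : Multiset ι).count_le_card j).trans (by rw [Sym.card_coe]; exact hn)

/-- **Assembly.** For side functions `F c` (`c : Bool`) that are smooth with
`|F_c|, |F_c'|, |F_c''| ≤ 1`, a scale `a` and a finite set `T` of patterns,
`Φ(x) = ∑_{b ∈ T} ∏_i F_{b i}(a x_i)` on `ℝ^ι` is `C²` with `|Φ|`, `‖DΦ‖`, `‖D²Φ‖` bounded. -/
theorem ri_sumprod_smooth {ι : Type*} [Fintype ι] [DecidableEq ι] (F : Bool → ℝ → ℝ)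
    (hF : ∀ c, ContDiff ℝ ∞ (F c))
    (hFb : ∀ c (k : ℕ), k ≤ 2 → ∀ t, ‖iteratedFDeriv ℝ k (F c) t‖ ≤ 1)
    (a : ℝ) (T : Finset (ι → Bool)) :
    ContDiff ℝ 2 (fun x : ι → ℝ => ∑ b ∈ T, ∏ i, F (b i) (a * x i)) ∧
    ∃ M : ℝ, (∀ x, |(fun x : ι → ℝ => ∑ b ∈ T, ∏ i, F (b i) (a * x i)) x| ≤ M) ∧
      (∀ x, ‖fderiv ℝ (fun x : ι → ℝ => ∑ b ∈ T, ∏ i, F (b i) (a * x i)) x‖ ≤ M) ∧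
      (∀ x, ‖fderiv ℝ (fderiv ℝ (fun x : ι → ℝ => ∑ b ∈ T, ∏ i, F (b i) (a * x i))) x‖
        ≤ M) := by
  set Φ : (ι → ℝ) → ℝ := fun x => ∑ b ∈ T, ∏ i, F (b i) (a * x i) with hΦ
  have hfi : ∀ (b : ι → Bool) (i : ι), ContDiff ℝ ∞ (fun x : ι → ℝ => F (b i) (a * x i)) :=
    fun b i => (hF (b i)).comp (contDiff_const.mul (contDiff_apply ℝ ℝ i))
  set R : ℝ := 1 + |a| + |a| ^ 2 with hR
  have hfb : ∀ (b : ι → Bool) (i : ι) (k : ℕ), k ≤ 2 → ∀ x,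
      ‖iteratedFDeriv ℝ k (fun x : ι → ℝ => F (b i) (a * x i)) x‖ ≤ R := by
    intro b i k hk x
    refine (ri_coord_bound (hF (b i)) (hFb (b i)) a i hk x).trans ?_
    have ha := abs_nonneg a
    interval_cases k
    · rw [pow_zero, hR]; nlinarith
    · rw [pow_one, hR]; nlinarith
    · rw [hR]; nlinarith
  have hterm : ∀ b : ι → Bool, ContDiff ℝ ∞ (fun x : ι → ℝ => ∏ i, F (b i) (a * x i)) :=
    fun b => contDiff_prod fun i _ => hfi b i
  set C : ℕ → ℝ := fun n => ∑ p ∈ (Finset.univ : Finset ι).sym n,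
    ((p : Multiset ι).countPerms : ℝ) * R ^ Fintype.card ι with hC
  have htermb : ∀ (n : ℕ), n ≤ 2 → ∀ (b : ι → Bool) x,
      ‖iteratedFDeriv ℝ n (fun x : ι → ℝ => ∏ i, F (b i) (a * x i)) x‖ ≤ C n :=
    fun n hn b x => ri_prod_bound (fun i => hfi b i) (fun i => hfb b i) hn x
  have hΦs : ContDiff ℝ ∞ Φ := ContDiff.sum fun b _ => hterm b
  have key : ∀ n : ℕ, n ≤ 2 → ∀ x, ‖iteratedFDeriv ℝ n Φ x‖ ≤ T.card * C n := by
    intro n hn x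
    have hs : iteratedFDeriv ℝ n Φ x =
        ∑ b ∈ T, iteratedFDeriv ℝ n (fun x : ι → ℝ => ∏ i, F (b i) (a * x i)) x :=
      iteratedFDeriv_fun_sum_apply fun b _ =>
        ((hterm b).of_le (by exact_mod_cast le_top)).contDiffAt
    rw [hs]
    refine (norm_sum_le _ _).trans ((Finset.sum_le_sum fun b _ => htermb n hn b x).trans ?_)
    rw [Finset.sum_const, nsmul_eq_mul]
  have hT : (0 : ℝ) ≤ T.card := Nat.cast_nonneg _
  refine ⟨contDiff_infty.1 hΦs 2, T.card * max (C 0) (max (C 1) (C 2)),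
    fun x => ?_, fun x => ?_, fun x => ?_⟩
  · rw [← Real.norm_eq_abs, ← norm_iteratedFDeriv_zero (𝕜 := ℝ)]
    exact (key 0 (by norm_num) x).trans (mul_le_mul_of_nonneg_left (le_max_left _ _) hT)
  · rw [← norm_iteratedFDeriv_zero (𝕜 := ℝ) (f := fderiv ℝ Φ), norm_iteratedFDeriv_fderiv]
    exact (key 1 (by norm_num) x).trans
      (mul_le_mul_of_nonneg_left (le_max_of_le_right (le_max_left _ _)) hT)
  · rw [← norm_iteratedFDeriv_zero (𝕜 := ℝ) (f := fderiv ℝ (fderiv ℝ Φ)),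
      norm_iteratedFDeriv_fderiv, norm_iteratedFDeriv_fderiv]
    exact (key 2 le_rfl x).trans
      (mul_le_mul_of_nonneg_left (le_max_of_le_right (le_max_right _ _)) hT)

/-! ### The product formula for the regularised indicator -/

/-- The product Gaussian measure of a coordinate box. -/
theorem ri_measureReal_pi_pi {ι : Type*} [Fintype ι] (s : ι → Set ℝ) :
    (Measure.pi fun _ : ι => gaussianReal 0 1).real (Set.pi univ s) =
      ∏ i, (gaussianReal 0 1).real (s i) := by
  simp only [measureReal_def, Measure.pi_pi, ENNReal.toReal_prod]

/-- **Product formula.** For `η > 0` there is a finite set `T` of sign patterns `b : I → Bool`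
(those whose open set `{e | b e}` lies in `A`) with
`regIndicator I A η x = ∑_{b ∈ T} ∏_i F_{b i}(−x_i/η)`, `F_true(t) = γ(Ioi t)`,
`F_false(t) = γ(Iic t)`: the fibre of the pattern `b` under `ζ ↦ (1[x_i + η ζ_i > 0])_i` is the
box `∏_i (b_i ? Ioi (−x_i/η) : Iic (−x_i/η))`. -/
theorem ri_regIndicator_eq (I : Finset (Sym2 (Site 2))) (A : Set (Set (Sym2 (Site 2)))) {η : ℝ}
    (hη : 0 < η) :
    ∃ T : Finset (I → Bool), regIndicator I A η = fun x => ∑ b ∈ T, ∏ i : I,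
      (fun (c : Bool) (t : ℝ) => (gaussianReal 0 1).real (if c then Ioi t else Iic t))
        (b i) (-η⁻¹ * x i) := by
  classical
  refine ⟨Finset.univ.filter fun b : I → Bool =>
    {e : Sym2 (Site 2) | ∃ h : e ∈ I, b ⟨e, h⟩ = true} ∈ A, ?_⟩
  funext x
  have harith : ∀ u z : ℝ, (0 < u + η * z ↔ -η⁻¹ * u < z) := fun u z => by
    rw [show -η⁻¹ * u = -u / η by ring, div_lt_iff₀ hη]
    constructor <;> intro h <;> linarith [mul_comm z η]
  have harith' : ∀ u z : ℝ, (¬(0 < u + η * z) ↔ z ≤ -η⁻¹ * u) := fun u z => by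
    rw [not_lt, show -η⁻¹ * u = -u / η by ring, le_div_iff₀ hη]
    constructor <;> intro h <;> linarith [mul_comm z η]
  -- the fibres of the sign-pattern map are coordinate boxes
  have hbox : ∀ b : I → Bool,
      (fun ζ : I → ℝ => fun i => decide (0 < x i + η * ζ i)) ⁻¹' {b} =
        Set.pi univ fun i => if b i then Ioi (-η⁻¹ * x i) else Iic (-η⁻¹ * x i) := by
    intro b
    ext ζ
    simp only [Set.mem_preimage, Set.mem_singleton_iff, Set.mem_univ_pi]
    rw [funext_iff]
    refine forall_congr' fun i => ?_
    rcases Bool.eq_false_or_eq_true (b i) with h | h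
    · rw [h]
      simp only [decide_eq_true_eq, if_true, Set.mem_Ioi]
      exact harith _ _
    · rw [h]
      simp only [decide_eq_false_iff_not, Bool.false_eq_true, if_false, Set.mem_Iic]
      exact harith' _ _
  have hmeas : ∀ b : I → Bool, MeasurableSet
      ((fun ζ : I → ℝ => fun i => decide (0 < x i + η * ζ i)) ⁻¹' {b}) := fun b => by
    rw [hbox]
    exact MeasurableSet.univ_pi fun i => by
      split_ifs
      exacts [measurableSet_Ioi, measurableSet_Iic]
  have hev :
      {ζ : I → ℝ | {e : Sym2 (Site 2) | ∃ h : e ∈ I, 0 < x ⟨e, h⟩ + η * ζ ⟨e, h⟩} ∈ A} =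
      (fun ζ : I → ℝ => fun i => decide (0 < x i + η * ζ i)) ⁻¹'
        ↑(Finset.univ.filter fun b : I → Bool =>
          {e : Sym2 (Site 2) | ∃ h : e ∈ I, b ⟨e, h⟩ = true} ∈ A) := by
    ext ζ
    simp only [Set.mem_setOf_eq, Set.mem_preimage, Finset.coe_filter, Finset.mem_univ,
      true_and, decide_eq_true_eq]
  unfold regIndicator
  rw [hev, ← sum_measureReal_preimage_singleton _ (fun b _ => hmeas b)]
  refine Finset.sum_congr rfl fun b _ => ?_
  rw [hbox, ri_measureReal_pi_pi]

/-! ### The registered sub-goal -/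

/-- **The noise-regularised indicator is `C²_b`** (sub-goal `pl_regIndicator_smooth` of the drift
identity of line `registered`, crux `DriftBound`): for `η > 0`, `Φ_η = regIndicator I A η` is
`C²` on `ℝ^I` and `|Φ_η|`, `‖DΦ_η‖`, `‖D²Φ_η‖` are bounded by one constant `M` (depending on `I`,
`A`, `η`). Product formula `ri_regIndicator_eq` + `ri_sumprod_smooth` with the Gaussian side
functions (`ri_side_contDiff`, `ri_side_bound`). -/
theorem pl_regIndicator_smooth : ∀ (I : Finset (Sym2 (Literature.Probability.LatticeModels.Site 2))) (A : Set (Set (Sym2 (Literature.Probability.LatticeModels.Site 2)))) (η : ℝ), 0 < η → ContDiff ℝ 2 (Summit.CriticalPhenomena.CardyFormulaZ2.Cruxes.DriftBound.Birth.regIndicator I A η) ∧ ∃ M : ℝ, (∀ x : I → ℝ, |Summit.CriticalPhenomena.CardyFormulaZ2.Cruxes.DriftBound.Birth.regIndicator I A η x| ≤ M) ∧ (∀ x : I → ℝ, ‖fderiv ℝ (Summit.CriticalPhenomena.CardyFormulaZ2.Cruxes.DriftBound.Birth.regIndicator I A η) x‖ ≤ M) ∧ (∀ x : I → ℝ, ‖fderiv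 ℝ (fderiv ℝ (Summit.CriticalPhenomena.CardyFormulaZ2.Cruxes.DriftBound.Birth.regIndicator I A η)) x‖ ≤ M) := by
  intro I A η hη
  obtain ⟨T, hT⟩ := ri_regIndicator_eq I A hη
  rw [hT]
  exact ri_sumprod_smooth
    (fun (c : Bool) (t : ℝ) => (gaussianReal 0 1).real (if c then Ioi t else Iic t))
    ri_side_contDiff ri_side_bound (-η⁻¹) T

end Summit.CriticalPhenomena.CardyFormulaZ2.Cruxes.DriftBound.Birth

end
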